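import Mathlib
import Summits.ResolutionOfSingularities.ResolutionOfSingularities.Theorems.RadicialJungCleanModelsLens5PRankTwoCurrency
import HarnessLib

/-!
# Lens 5 — PRankTwo SEP-FIN / SEP-INF / SEP-RES currency (THEOREMS T″ ⊃ T′_∞ ⊃ T′_fin ⊃ T′₁; T″ ⊇ T in kernel) + UPTAKE glue: PORT-READY CANDIDATE (superset of the g13 candidate)

Crux workfile `Cruxes/DescentPerfectToAll/Lens5_TPrimeInfCurrency.lean` (res-B-lens-5 g14) = the g13 candidate `Lens5_TPrimeCurrency.lean`
(7c7e46e2b70d) BYTE-IDENTICAL plus §B″ (the currency of THEOREM T′_∞: `IsPSpanningFamilyInf`, `ResiduallyPIndependentFamilyInf`,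
`CleanLU3DefectPRankTwoSepInfAt`, the three finite ↔ finitely-supported conversions) and the corollary T′_fin ⊂ T′_∞
(`cleanLU3DefectPRankTwoSepFin_of_sepInf`); SAME namespace, so the porter's target module is unchanged and ONE currency module serves
T′₁ / T′_fin / T′_∞.  OURS · CANDIDATE · counted 0; nothing here proves resolution in characteristic `p`; resolution in char p NOT proved.

This file is the DEFINITIONS-ONLY part (§B/§B′ of `Lens5_TPrime.lean` rev 3 a15aee1d26d5 and §B″ of `Lens5_TPrimeInf.lean` rev 1),
token-identical, plus Mathlib-only sanity lemmas (§C′ bridge B1 in the `k`-rational case; T′₁ ⊂ T′_fin ⊂ T′_∞; T′_fin ⊇ T up to (SEP-K)),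
laid out exactly like the ported currency of THEOREM T (✓ `Theorems/RadicialJungCleanModelsLens5PRankTwoCurrency.lean`) so that a porter can
byte-copy it to `Theorems/RadicialJungCleanModelsLens5PRankTwoSepFinCurrency.lean` — which is what the lead's rev 29 of
`Cruxes/CleanModels/Lines/Sketch.lean` needs in order to STATE the fifth negated side condition of `stub_cleanLU3DefectNonDiscrete`
(critic TRIAGE-135: «currency defs must be importable from a Theorems/ module before rev 29 states it»).  When the theorem file
`Lens5_TPrimeInf.lean` (which subsumes `Lens5_TPrime.lean` rev 3) is ported afterwards, its §B/§B′/§B″ definitions and conversions and the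
statement-level corollaries of §H∞ are DELETED there and this namespace is opened instead.

## Contents
* `SepGenerated k K` — `K/k` separably generated.
* `IsPGenerator p θ`, `ResiduallyPIndependent p O Θ`, `CleanLU3DefectPRankTwoSepRkOneAt p` — T′₁'s currency (`p`-rank one).
* `IsPSpanningFamily p b`, `ResiduallyPIndependentFamily p O B`, `CleanLU3DefectPRankTwoSepFinAt p` — T′_fin's currency (finite `p`-rank).
* `IsPSpanningFamilyInf p b`, `ResiduallyPIndependentFamilyInf p O B`, `CleanLU3DefectPRankTwoSepInfAt p` — T′_∞'s currency (arbitrary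
  `p`-rank, finitely supported sums); `residuallyPIndependentFamily_restrict`, `isPSpanningFamilyInf_of_fintype`,
  `residuallyPIndependentFamilyInf_of_fintype` — finite ↔ finitely supported.
* `exists_isPSpanningFamilyInf` — every field of char `p` has a (SPAN∞) family (a `k^p`-basis); `eq_zero_of_residuallyPIndependentFamilyInf` —
  (RPI∞) forces `k^p`-linear independence.
* `cleanLU3DefectPRankTwoSepFin_of_sepInf` — T′_fin's slice from T′_∞'s (a finite family is finitely supported).
* §I (rev 2): `pow_linearIndependent_of_isSeparable` (Mac Lane's criterion, separable direction: a `k^p`-independent family of a field `k` stays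
  `κ^p`-independent in any SEPARABLE extension `κ/k` — Mathlib `IntermediateField.linearDisjoint_of_isPurelyInseparable_of_isSeparable`),
  `residuallyPIndependentFamilyInf_of_isSeparable` (Bridge B1: `κ_v/k` separable ⇒ (RPI∞) for every `k^p`-independent family of constants),
  `exists_pBasisFamilyInf` (every field has a `k^p`-basis), `CleanLU3DefectPRankTwoSepResAt p` (T″'s slice: (P2) × (SEP-K) × «`κ_v/k`
  separable» as `Algebra.IsSeparable k (IsLocalRing.ResidueField O)` for any compatible algebra structure — NO auxiliary family) and
  `cleanLU3DefectPRankTwoSepRes_of_sepInf` (T″ ⊂ T′_∞).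
* §J (rev 3, UPTAKE): `cleanLUConcl_of_sepRes` — the ∃-form of T″ matching the binders of `stub_cleanLU3DefectNonDiscrete` (Sketch rev 28 :279) for
  the lead's `by_cases` in `cleanLU3DefectNonDiscrete_of_stubs` (template in the docstring); `sepGenerated_of_perfectField` — (SEP-K) is AUTOMATIC for
  `K = Frac A`, `A` of finite type over a PERFECT `k` (Mathlib `exists_isTranscendenceBasis_and_isSeparable_of_perfectField`), so T″ ⊇ T exactly
  whenever `κ_v/k` is separable algebraic.
* §K (rev 4): `residue_isIntegral_of_centres_maximal` / `isAlgebraic_residueField_of_centres_maximal` — in the :279 regime (`hzd`: the centre of `v` on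
  every finite-type model `T ⊇ A` in `O_v` is maximal) the residue field `κ_v` is ALGEBRAIC over `k` (Zariski's lemma on the model `A[o]`, Mathlib
  `MvPolynomial.comp_C_integral_of_surjective_of_isJacobsonRing`, and `A[o]/𝔠 ↪ κ_v`); hence **T″ ⊇ T IN KERNEL**:
  `cleanLU3DefectPRankTwo_of_sepRes : CleanLU3DefectPRankTwoSepResAt p → CleanLU3DefectPRankTwoAt p` (over a perfect `k`, (SEP-K) is free by §J and
  `κ_v/k` is separable by Mathlib `Algebra.IsAlgebraic.isSeparable_of_perfectField`).
* `residuallyPIndependentFamily_of_rational` — bridge B1 on `k`-rational valuations: (RPI-fam) ⟸ `k^p`-linear independence of `b`.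
* `cleanLU3DefectPRankTwoSepRkOne_of_sepFin` — T′₁'s slice from T′_fin's (`S := Fin p`, `b i := θ^i`).
* `cleanLU3DefectPRankTwo_sep_of_sepFin` — T′_fin's slice gives T's slice ✓`CleanLU3DefectPRankTwoAt p` plus the binder `SepGenerated k K`
  (`S := Unit`, `b := 1` over a perfect `k`).
-/

noncomputable section

set_option linter.dupNamespace false

open IsLocalRing
open Literature.AlgebraicGeometry.Resolution
open Summit.ResolutionOfSingularities.ResolutionOfSingularities.Theorems.RadicialJung.CleanModels.Lens5.PRankTwoCurrency

namespace Summit.ResolutionOfSingularities.ResolutionOfSingularities.Theorems.RadicialJung.CleanModels.Lens5.PRankTwoSepFinCurrency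

/-! ## §B Currency of T′₁ (`p`-rank one; kept — T′₁ is the corollary `S := Fin p`, `b i := θ^i` of T′_fin, §H) -/

/-- `K/k` separably generated (census `Census_lens5_pRankTwo.lean` def, verbatim). [folklore] -/
def SepGenerated (k K : Type) [Field k] [Field K] [Algebra k K] : Prop :=
    ∃ (n : ℕ) (s : Fin n → K), AlgebraicIndependent k s ∧ Algebra.IsSeparable (IntermediateField.adjoin k (Set.range s)) K

/-- **`θ` is a `p`-generator of `k`**: `k = k^p[θ] = Σ_{i<p} k^p θ^i`, i.e. `[k : k^p] ≤ p` (`p`-rank ≤ 1). [folklore] -/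
def IsPGenerator (p : ℕ) {k : Type} [Field k] (θ : k) : Prop :=
    ∀ c : k, ∃ d : Fin p → k, c = ∑ i : Fin p, d i ^ p * θ ^ (i : ℕ)

/-- **Residual `p`-independence of `1, Θ, …, Θ^{p-1}`** along `v` (in-`K` form): a combination `Σ_{i<p} w_i^p Θ^i` with integral
coefficients one of which is a unit is a unit.  For `Θ ∈ k` and `κ_v/k` algebraic this says that the `p`-basis `{θ}` of `k` stays
`p`-independent in `κ_v`, i.e. `κ_v/k` is separable. [folklore] -/
def ResiduallyPIndependent (p : ℕ) {K : Type} [Field K] (O : ValuationSubring K) (Θ : K) : Prop :=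
    ∀ w : Fin p → K, (∀ i, w i ∈ O) → (∃ i, O.valuation (w i) = 1) →
      O.valuation (∑ i : Fin p, w i ^ p * Θ ^ (i : ℕ)) = 1

/-- **THEOREM T′₁'s slice**: `stub_cleanLU3DefectNonDiscrete` at `p` on {`[Γ : pΓ] = p²`, `K/k` separably generated, `k` of
`p`-rank ≤ 1 with `p`-generator `θ` residually `p`-independent along `v`} — NO `PerfectField k`. [folklore] -/
def CleanLU3DefectPRankTwoSepRkOneAt (p : ℕ) : Prop :=
    ∀ (k : Type) [Field k] [CharP k p] (K : Type) [Field K] [Algebra k K]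
    (O : ValuationSubring K) (A : Subalgebra k K), A.toSubring ≤ O.toSubring → A.FG → IsFractionRing A K →
    ringKrullDim A ≤ 3 → IsRegularLocalRing (locAtCentre A.toSubring O) →
    ringKrullDim (locAtCentre A.toSubring O) = 3 →
    (∀ (T : Subring K) (hT : T ≤ O.toSubring), A.toSubring ≤ T → (subringCentre T O hT).IsMaximal) →
    ∀ g₀ : K, (∀ c : K, c ^ p ≠ g₀) →
    (∀ f₀ : K, ∃ f₁ : K, O.valuation (g₀ - f₁ ^ p) < O.valuation (g₀ - f₀ ^ p)) →
    (∀ hk : ∀ c : k, algebraMap k K c ∈ O, transcendenceDefect k O hk ≠ 0) →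
    ¬ (∃ π : K, π ≠ 0 ∧ (∀ x : K, O.valuation x < 1 → O.valuation x ≤ O.valuation π) ∧
      (∀ x : K, x ≠ 0 → ∃ n : ℕ, O.valuation π ^ n ≤ O.valuation x)) →
    PRankTwoAt p O → SepGenerated k K →
    ∀ θ : k, IsPGenerator p θ → ResiduallyPIndependent p O (algebraMap k K θ) →
    CleanLUConcl p k K O A g₀

/-! ### §B′ Currency of T′_fin (finite `p`-rank): a finite `p`-spanning family of `k`, residually `p`-independent along `v` -/

/-- **A finite `p`-spanning family of `k`**: `k = Σ_{s ∈ S} k^p · b_s` (`S` finite).  Any field of FINITE `p`-rank `e` has one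
(the `p^e` monomials in a `p`-basis); `p`-rank one = the family `1, θ, …, θ^{p-1}`. [folklore] -/
def IsPSpanningFamily (p : ℕ) {k : Type} [Field k] {S : Type} [Fintype S] (b : S → k) : Prop :=
    ∀ c : k, ∃ d : S → k, c = ∑ s : S, d s ^ p * b s

/-- **Residual `p`-independence of a finite family** `B : S → K` along `v` (in-`K` form): `Σ_s w_s^p B_s` is a `v`-unit whenever the
`w_s ∈ O` are not all in `𝔪_v`.  For `B = b` a `p`-spanning family of `k ⊆ O` and `κ_v/k` algebraic this says that the `p`-basis of `k`
extracted from `b` stays `p`-independent in `κ_v`, i.e. (MacLane) `κ_v/k` is SEPARABLE. [folklore] -/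
def ResiduallyPIndependentFamily (p : ℕ) {K : Type} [Field K] (O : ValuationSubring K) {S : Type} [Fintype S]
    (B : S → K) : Prop :=
    ∀ w : S → K, (∀ s, w s ∈ O) → (∃ s, O.valuation (w s) = 1) → O.valuation (∑ s : S, w s ^ p * B s) = 1

/-- **THEOREM T′_fin's slice**: `stub_cleanLU3DefectNonDiscrete` at `p` on {`[Γ : pΓ] = p²`, `K/k` separably generated, `k` with a
FINITE `p`-spanning family (finite `p`-rank) residually `p`-independent along `v`} — NO `PerfectField k`. [folklore] -/
def CleanLU3DefectPRankTwoSepFinAt (p : ℕ) : Prop :=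
    ∀ (k : Type) [Field k] [CharP k p] (K : Type) [Field K] [Algebra k K]
    (O : ValuationSubring K) (A : Subalgebra k K), A.toSubring ≤ O.toSubring → A.FG → IsFractionRing A K →
    ringKrullDim A ≤ 3 → IsRegularLocalRing (locAtCentre A.toSubring O) →
    ringKrullDim (locAtCentre A.toSubring O) = 3 →
    (∀ (T : Subring K) (hT : T ≤ O.toSubring), A.toSubring ≤ T → (subringCentre T O hT).IsMaximal) →
    ∀ g₀ : K, (∀ c : K, c ^ p ≠ g₀) →
    (∀ f₀ : K, ∃ f₁ : K, O.valuation (g₀ - f₁ ^ p) < O.valuation (g₀ - f₀ ^ p)) →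
    (∀ hk : ∀ c : k, algebraMap k K c ∈ O, transcendenceDefect k O hk ≠ 0) →
    ¬ (∃ π : K, π ≠ 0 ∧ (∀ x : K, O.valuation x < 1 → O.valuation x ≤ O.valuation π) ∧
      (∀ x : K, x ≠ 0 → ∃ n : ℕ, O.valuation π ^ n ≤ O.valuation x)) →
    PRankTwoAt p O → SepGenerated k K →
    ∀ (S : Type) [Fintype S] (b : S → k), IsPSpanningFamily p b →
    ResiduallyPIndependentFamily p O (fun s => algebraMap k K (b s)) →
    CleanLUConcl p k K O A g₀


/-! ### §B″ Currency of T′_∞ (ARBITRARY `p`-rank, new in this file): a `p`-spanning family of `k` indexed by ANY type `S`, residually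
`p`-independent along `v` on every finite subfamily; all sums finitely supported -/

/-- **A `p`-spanning family of `k` indexed by an arbitrary type**: every `c ∈ k` is a FINITE sum `Σ_{s ∈ s₀} d_s^p b_s`.  EVERY field of
characteristic `p` has one (the monomials with exponents `< p` in a `p`-basis — or simply `b := id`); `S` must be infinite iff `[k : k^p] = ∞`. [folklore] -/
def IsPSpanningFamilyInf (p : ℕ) {k : Type} [Field k] {S : Type} (b : S → k) : Prop :=
    ∀ c : k, ∃ (s : Finset S) (d : S → k), c = ∑ i ∈ s, d i ^ p * b i

/-- **Residual `p`-independence of an arbitrary family** `B : S → K` along `v` (in-`K` form): on every finite `s₀ ⊆ S`,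
`Σ_{s ∈ s₀} w_s^p B_s` is a `v`-unit whenever the `w_s ∈ O` are not all in `𝔪_v` on `s₀`.  For `B = b` a `p`-spanning family of `k ⊆ O`
this says (MacLane) that `κ_v/k` is SEPARABLE and `b` stays `p`-independent in `κ_v`. [folklore] -/
def ResiduallyPIndependentFamilyInf (p : ℕ) {K : Type} [Field K] (O : ValuationSubring K) {S : Type} (B : S → K) : Prop :=
    ∀ (s : Finset S) (w : S → K), (∀ i, w i ∈ O) → (∃ i ∈ s, O.valuation (w i) = 1) →
      O.valuation (∑ i ∈ s, w i ^ p * B i) = 1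

/-- **THEOREM T′_∞'s slice**: `stub_cleanLU3DefectNonDiscrete` at `p` on {`[Γ : pΓ] = p²`, `K/k` separably generated, `k` of ARBITRARY
(possibly infinite) `p`-rank carrying a `p`-spanning family residually `p`-independent along `v`} — NO `PerfectField k`, NO finiteness of
`[k : k^p]`. [folklore] -/
def CleanLU3DefectPRankTwoSepInfAt (p : ℕ) : Prop :=
    ∀ (k : Type) [Field k] [CharP k p] (K : Type) [Field K] [Algebra k K]
    (O : ValuationSubring K) (A : Subalgebra k K), A.toSubring ≤ O.toSubring → A.FG → IsFractionRing A K →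
    ringKrullDim A ≤ 3 → IsRegularLocalRing (locAtCentre A.toSubring O) →
    ringKrullDim (locAtCentre A.toSubring O) = 3 →
    (∀ (T : Subring K) (hT : T ≤ O.toSubring), A.toSubring ≤ T → (subringCentre T O hT).IsMaximal) →
    ∀ g₀ : K, (∀ c : K, c ^ p ≠ g₀) →
    (∀ f₀ : K, ∃ f₁ : K, O.valuation (g₀ - f₁ ^ p) < O.valuation (g₀ - f₀ ^ p)) →
    (∀ hk : ∀ c : k, algebraMap k K c ∈ O, transcendenceDefect k O hk ≠ 0) →
    ¬ (∃ π : K, π ≠ 0 ∧ (∀ x : K, O.valuation x < 1 → O.valuation x ≤ O.valuation π) ∧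
      (∀ x : K, x ≠ 0 → ∃ n : ℕ, O.valuation π ^ n ≤ O.valuation x)) →
    PRankTwoAt p O → SepGenerated k K →
    ∀ (S : Type) (b : S → k), IsPSpanningFamilyInf p b →
    ResiduallyPIndependentFamilyInf p O (fun s => algebraMap k K (b s)) →
    CleanLUConcl p k K O A g₀

/-- Restriction of a residually `p`-independent family to a finite subfamily (the finite notion of §B′ on the subtype `↥s`). [folklore] -/
theorem residuallyPIndependentFamily_restrict {p : ℕ} {K : Type} [Field K] (O : ValuationSubring K) {S : Type} (B : S → K)
    (hPI : ResiduallyPIndependentFamilyInf p O B) (s : Finset S) :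
    ResiduallyPIndependentFamily p O (fun i : ↥s => B i) := by
  classical
  intro w hw hw1
  let w' : S → K := fun j => if h : j ∈ s then w ⟨j, h⟩ else 0
  have hw'in : ∀ i : ↥s, w' i = w i := fun i => by
    show (if h : (i : S) ∈ s then w ⟨i, h⟩ else 0) = w i
    rw [dif_pos i.2]
  have hw'out : ∀ j, j ∉ s → w' j = 0 := fun j hj => by
    show (if h : j ∈ s then w ⟨j, h⟩ else 0) = 0
    rw [dif_neg hj]
  have hsum : ∑ i : ↥s, w i ^ p * B i = ∑ j ∈ s, w' j ^ p * B j := by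
    rw [← Finset.sum_coe_sort s]
    exact Finset.sum_congr rfl fun i _ => by rw [hw'in i]
  rw [hsum]
  refine hPI s w' (fun j => ?_) ?_
  · by_cases h : j ∈ s
    · rw [show w' j = w ⟨j, h⟩ from hw'in ⟨j, h⟩]; exact hw _
    · rw [hw'out j h]; exact O.zero_mem
  · obtain ⟨i, hi⟩ := hw1
    exact ⟨i, i.2, by rw [hw'in i]; exact hi⟩

/-- A finite `p`-spanning family (§B′) is a `p`-spanning family in the sense of §B″. [folklore] -/
theorem isPSpanningFamilyInf_of_fintype {p : ℕ} {k : Type} [Field k] {S : Type} [Fintype S] (b : S → k)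
    (hb : IsPSpanningFamily p b) : IsPSpanningFamilyInf p b := fun c => by
  obtain ⟨d, hd⟩ := hb c
  exact ⟨Finset.univ, d, hd⟩

/-- A finite residually `p`-independent family (§B′) is residually `p`-independent in the sense of §B″ (`p ≠ 0`). [folklore] -/
theorem residuallyPIndependentFamilyInf_of_fintype {p : ℕ} (hp : p ≠ 0) {K : Type} [Field K] (O : ValuationSubring K)
    {S : Type} [Fintype S] (B : S → K) (hPI : ResiduallyPIndependentFamily p O B) :
    ResiduallyPIndependentFamilyInf p O B := by
  classical
  intro s w hw hw1
  let w' : S → K := fun j => if j ∈ s then w j else 0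
  have hin : ∀ j ∈ s, w' j = w j := fun j hj => by
    show (if j ∈ s then w j else 0) = w j
    rw [if_pos hj]
  have hout : ∀ j, j ∉ s → w' j = 0 := fun j hj => by
    show (if j ∈ s then w j else 0) = 0
    rw [if_neg hj]
  have hsum : ∑ j ∈ s, w j ^ p * B j = ∑ j : S, w' j ^ p * B j := by
    have h1 : ∑ j ∈ s, w' j ^ p * B j = ∑ j : S, w' j ^ p * B j :=
      Finset.sum_subset (Finset.subset_univ s) (fun j _ hj => by rw [hout j hj, zero_pow hp, zero_mul])
    rw [← h1]
    exact Finset.sum_congr rfl fun j hj => by rw [hin j hj]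
  rw [hsum]
  refine hPI w' (fun j => ?_) ?_
  · by_cases h : j ∈ s
    · rw [hin j h]; exact hw _
    · rw [hout j h]; exact O.zero_mem
  · obtain ⟨i, hi, hvi⟩ := hw1
    exact ⟨i, by rw [hin i hi]; exact hvi⟩


/-! ### §C′ Bridge B1 in the `k`-RATIONAL case: for a valuation with residue field `k` (every element of `O` is congruent to a constant),
residual `p`-independence of `b` read in `K` is just `k^p`-linear independence of `b` in `k` (so (FIN)+(RPI-fam) = «`b` is a `p`-basis-monomial
basis of `k` over `k^p`»).  The general bridge («`κ_v/k` separable algebraic», Mac Lane) is by hand in the memo (§17/§18), not formalised. -/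

/-- Constants are `v`-units. [folklore] -/
theorem valuation_algebraMap_eq_one {k K : Type} [Field k] [Field K] [Algebra k K] (O : ValuationSubring K)
    (hk : ∀ c : k, algebraMap k K c ∈ O) {c : k} (hc : c ≠ 0) : O.valuation (algebraMap k K c) = 1 := by
  have h1 : O.valuation (algebraMap k K c) ≤ 1 := (O.valuation_le_one_iff _).mpr (hk c)
  have h2 : O.valuation (algebraMap k K c⁻¹) ≤ 1 := (O.valuation_le_one_iff _).mpr (hk c⁻¹)
  have hprod : O.valuation (algebraMap k K c) * O.valuation (algebraMap k K c⁻¹) = 1 := by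
    rw [← map_mul, ← map_mul, mul_inv_cancel₀ hc, map_one, map_one]
  refine le_antisymm h1 ?_
  calc (1 : _) = O.valuation (algebraMap k K c) * O.valuation (algebraMap k K c⁻¹) := hprod.symm
    _ ≤ O.valuation (algebraMap k K c) * 1 := by gcongr
    _ = O.valuation (algebraMap k K c) := mul_one _

/-- **Bridge B1, `k`-rational case.**  If the residue field of `v` is `k` (`hrat`: every `x ∈ O` is `≡` a constant mod `𝔪_v`) and the finite
family `b` is `k^p`-linearly independent in `k` (`hbli`, in-`k` elementary form), then `b` is residually `p`-independent along `v`. [folklore] -/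
theorem residuallyPIndependentFamily_of_rational (p : ℕ) [Fact p.Prime] {k K : Type} [Field k] [CharP k p] [Field K] [Algebra k K]
    (O : ValuationSubring K) (hk : ∀ c : k, algebraMap k K c ∈ O)
    (hrat : ∀ x : K, x ∈ O → ∃ c : k, O.valuation (x - algebraMap k K c) < 1)
    {S : Type} [Fintype S] (b : S → k) (hbli : ∀ d : S → k, ∑ s, d s ^ p * b s = 0 → ∀ s, d s = 0) :
    ResiduallyPIndependentFamily p O (fun s => algebraMap k K (b s)) := by
  classical
  have hp : p.Prime := Fact.out
  haveI : CharP K p := charP_of_injective_algebraMap (algebraMap k K).injective p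
  intro w hw hw1
  obtain ⟨s₀, hs₀⟩ := hw1
  choose c hc using fun s => hrat (w s) (hw s)
  -- the unit coefficient has a non-zero constant
  have hc₀ : c s₀ ≠ 0 := by
    intro h0
    have := hc s₀
    rw [h0, map_zero, sub_zero, hs₀] at this
    exact lt_irrefl _ this
  -- hence the constant combination is a non-zero constant, a `v`-unit
  have hsum0 : ∑ s, c s ^ p * b s ≠ 0 := fun h0 => hc₀ (hbli c h0 s₀)
  have hunit : O.valuation (algebraMap k K (∑ s, c s ^ p * b s)) = 1 := valuation_algebraMap_eq_one O hk hsum0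
  -- the difference lies in `𝔪_v`
  set D : K := ∑ s, (w s ^ p - algebraMap k K (c s) ^ p) * algebraMap k K (b s) with hD
  have hDlt : O.valuation D < 1 := by
    refine Valuation.map_sum_lt _ one_ne_zero fun s _ => ?_
    rw [← sub_pow_char, map_mul, map_pow]
    have hb1 : O.valuation (algebraMap k K (b s)) ≤ 1 := (O.valuation_le_one_iff _).mpr (hk _)
    calc O.valuation (w s - algebraMap k K (c s)) ^ p * O.valuation (algebraMap k K (b s))
        ≤ O.valuation (w s - algebraMap k K (c s)) ^ p * 1 := by gcongr
      _ = O.valuation (w s - algebraMap k K (c s)) ^ p := mul_one _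
      _ < 1 := pow_lt_one₀ zero_le (hc s) hp.ne_zero
  have hsplit : ∑ s, w s ^ p * algebraMap k K (b s) = algebraMap k K (∑ s, c s ^ p * b s) + D := by
    rw [hD, map_sum, ← Finset.sum_add_distrib]
    refine Finset.sum_congr rfl fun s _ => ?_
    rw [map_mul, map_pow]; ring
  rw [hsplit, Valuation.map_add_eq_of_lt_left _ (by rw [hunit]; exact hDlt), hunit]

/-! ### §B‴ Two sanity lemmas on the currency of T′_∞ (Mathlib only) -/

/-- **Every field of characteristic `p` carries a `p`-spanning family with finitely supported sums**: any `k^p`-basis of `k`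
(so the currency of T′_∞ quantifies over a non-empty set of families for EVERY ground field; the content is in (RPI∞)). [folklore] -/
theorem exists_isPSpanningFamilyInf (p : ℕ) [Fact p.Prime] (k : Type) [Field k] [CharP k p] :
    ∃ (S : Type) (b : S → k), IsPSpanningFamilyInf p b := by
  classical
  let kp : Subfield k := (frobenius k p).fieldRange
  let B := Module.Free.chooseBasis kp k
  have hroot : ∀ x : kp, ∃ d : k, d ^ p = (x : k) := fun x => by
    obtain ⟨d, hd⟩ := RingHom.mem_fieldRange.mp x.2
    exact ⟨d, by rw [← hd, frobenius_def]⟩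
  choose rt hrt using hroot
  refine ⟨Module.Free.ChooseBasisIndex kp k, fun i => B i, fun c => ⟨(B.repr c).support, fun i => rt (B.repr c i), ?_⟩⟩
  conv_lhs => rw [← B.linearCombination_repr c, Finsupp.linearCombination_apply, Finsupp.sum]
  refine Finset.sum_congr rfl fun i _ => ?_
  rw [hrt, Subfield.smul_def, smul_eq_mul]

/-- **(RPI∞) forces `k^p`-linear independence** (in-`k` elementary form): a residually `p`-independent family of constants has no
non-trivial relation `Σ_{s ∈ s₀} d_s^p b_s = 0` in `k` (the `d_s ≠ 0` are `v`-units).  So (SPAN∞)+(RPI∞) say «`b` is a `k^p`-BASIS of `k`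
whose residues stay `κ_v^p`-independent» (= «`κ_v/k` separable», MacLane — by hand). [folklore] -/
theorem eq_zero_of_residuallyPIndependentFamilyInf (p : ℕ) {k K : Type} [Field k] [Field K] [Algebra k K]
    (O : ValuationSubring K) (hk : ∀ c : k, algebraMap k K c ∈ O) {S : Type} (b : S → k)
    (hPI : ResiduallyPIndependentFamilyInf p O (fun s => algebraMap k K (b s)))
    (s₀ : Finset S) (d : S → k) (hrel : ∑ i ∈ s₀, d i ^ p * b i = 0) : ∀ i ∈ s₀, d i = 0 := by
  by_contra hne
  push Not at hne
  obtain ⟨i, hi, hdi⟩ := hne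
  have h1 := hPI s₀ (fun j => algebraMap k K (d j)) (fun j => hk (d j))
    ⟨i, hi, valuation_algebraMap_eq_one O hk hdi⟩
  have h0 : ∑ j ∈ s₀, algebraMap k K (d j) ^ p * algebraMap k K (b j) = 0 := by
    rw [← show algebraMap k K (∑ j ∈ s₀, d j ^ p * b j) = ∑ j ∈ s₀, algebraMap k K (d j) ^ p * algebraMap k K (b j) by
      rw [map_sum]; exact Finset.sum_congr rfl fun j _ => by rw [map_mul, map_pow], hrel, map_zero]
  rw [h0, map_zero] at h1
  exact zero_ne_one h1

/-! ## §2 The specialisations: T′_fin ⊂ T′_∞, T′₁ ⊂ T′_fin, T ⊂ T′_fin up to (SEP-K) -/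

/-- **T′_fin ⊂ T′_∞**: the finite-`p`-rank slice is the case `S` finite of the arbitrary-`p`-rank slice (a finite family is finitely
supported; §B″ conversions). [folklore] -/
theorem cleanLU3DefectPRankTwoSepFin_of_sepInf (p : ℕ) [Fact p.Prime]
    (hInf : CleanLU3DefectPRankTwoSepInfAt p) : CleanLU3DefectPRankTwoSepFinAt p := by
  intro k _ _ K _ _ O A hAO hAfg hFrac hdimA hreg hdim3 hzd g₀ hg₀ hdefect htd hnd hP2 hsep S _ b hb hPI
  have hp : p.Prime := Fact.out
  exact hInf k K O A hAO hAfg hFrac hdimA hreg hdim3 hzd g₀ hg₀ hdefect htd hnd hP2 hsep S b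
    (isPSpanningFamilyInf_of_fintype b hb)
    (residuallyPIndependentFamilyInf_of_fintype hp.ne_zero O (fun s => algebraMap k K (b s)) hPI)


/-- **T′₁ ⊂ T′_fin**: the `p`-rank-one slice is the case `S := Fin p`, `b i := θ^i` of the finite-`p`-rank slice. [folklore] -/
theorem cleanLU3DefectPRankTwoSepRkOne_of_sepFin (p : ℕ) [Fact p.Prime]
    (hFin : CleanLU3DefectPRankTwoSepFinAt p) : CleanLU3DefectPRankTwoSepRkOneAt p := by
  intro k _ _ K _ _ O A hAO hAfg hFrac hdimA hreg hdim3 hzd g₀ hg₀ hdefect htd hnd hP2 hsep θ hθ hPI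
  refine hFin k K O A hAO hAfg hFrac hdimA hreg hdim3 hzd g₀ hg₀ hdefect htd hnd hP2 hsep (Fin p)
    (fun i => θ ^ (i : ℕ)) (fun c => hθ c) ?_
  intro w hw hw1
  simpa only [map_pow] using hPI w hw hw1

/-- **T′_fin ⊇ T up to (SEP-K)** (statement-level sanity of the new slice — the degenerate instance of §B′; not used elsewhere): over a PERFECT
field the one-element family `b = 1` is `p`-spanning (`c = (c^{1/p})^p`) and trivially residually `p`-independent, so
`CleanLU3DefectPRankTwoSepFinAt p` yields the conclusion of T's slice ✓ `CleanLU3DefectPRankTwoAt p` under the single extra binder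
`SepGenerated k K` (automatic for `K` finitely generated over a perfect field, Hartshorne I.4.8A — not formalised here). [folklore] -/
theorem cleanLU3DefectPRankTwo_sep_of_sepFin (p : ℕ) [Fact p.Prime] (hFin : CleanLU3DefectPRankTwoSepFinAt p) :
    ∀ (k : Type) [Field k] [CharP k p] [PerfectField k] (K : Type) [Field K] [Algebra k K]
    (O : ValuationSubring K) (A : Subalgebra k K), A.toSubring ≤ O.toSubring → A.FG → IsFractionRing A K →
    ringKrullDim A ≤ 3 → IsRegularLocalRing (locAtCentre A.toSubring O) →
    ringKrullDim (locAtCentre A.toSubring O) = 3 →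
    (∀ (T : Subring K) (hT : T ≤ O.toSubring), A.toSubring ≤ T → (subringCentre T O hT).IsMaximal) →
    ∀ g₀ : K, (∀ c : K, c ^ p ≠ g₀) →
    (∀ f₀ : K, ∃ f₁ : K, O.valuation (g₀ - f₁ ^ p) < O.valuation (g₀ - f₀ ^ p)) →
    (∀ hk : ∀ c : k, algebraMap k K c ∈ O, transcendenceDefect k O hk ≠ 0) →
    ¬ (∃ π : K, π ≠ 0 ∧ (∀ x : K, O.valuation x < 1 → O.valuation x ≤ O.valuation π) ∧
      (∀ x : K, x ≠ 0 → ∃ n : ℕ, O.valuation π ^ n ≤ O.valuation x)) →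
    PRankTwoAt p O → SepGenerated k K →
    CleanLUConcl p k K O A g₀ := by
  intro k _ _ _ K _ _ O A hAO hAfg hFrac hdimA hreg hdim3 hzd g₀ hg₀ hdefect htd hnd hP2 hsep
  have hp : p.Prime := Fact.out
  haveI : ExpChar k p := ExpChar.prime hp
  haveI : PerfectRing k p := PerfectField.toPerfectRing p
  refine hFin k K O A hAO hAfg hFrac hdimA hreg hdim3 hzd g₀ hg₀ hdefect htd hnd hP2 hsep Unit (fun _ => (1 : k)) ?_ ?_
  · intro c
    obtain ⟨d, hd⟩ := surjective_frobenius k p c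
    refine ⟨fun _ => d, ?_⟩
    rw [Fintype.sum_unique, mul_one, ← hd, frobenius_def]
  · rintro w - ⟨s, hs⟩
    rw [Fintype.sum_unique, map_one, mul_one, map_pow, Subsingleton.elim (default : Unit) s, hs, one_pow]


/-! ## §I (rev 2) THEOREM T″ — the slice stated with «`κ_v/k` SEPARABLE» (Mathlib's `Algebra.IsSeparable`) in place of the family `b`

Bridge B1 (Mac Lane 1939, separable direction) IN KERNEL: if the residue field `κ_v = O/𝔪_v` is separable over `k` (for ANY `k`-algebra
structure on `κ_v` compatible with `k → O → κ_v`), then EVERY `k^p`-linearly independent family of constants is residually `p`-independent along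
`v` (§B″ (RPI∞)); the proof is Mathlib's linear disjointness of a separable and a purely inseparable extension
(`IntermediateField.linearDisjoint_of_isPurelyInseparable_of_isSeparable`, applied to `κ_v^p ⊇ k^p` separable and `k ⊇ k^p` purely inseparable
inside `κ_v`, after transporting `κ_v/k` to `κ_v^p/k^p` along the two Frobenius isomorphisms).  Since every field has a `k^p`-basis
(`exists_pBasisFamilyInf`), T′_∞ yields **T″**: `stub_cleanLU3DefectNonDiscrete` on {(P2)} × {`K/k` separably generated} × {`κ_v/k` separable},
with NO auxiliary family in the statement. -/

/-- **Mac Lane's criterion, separable direction (elementary form).**  If `κ/k` is a separable field extension in characteristic `p` and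
`b : S → k` is `k^p`-linearly independent (no non-trivial relation `Σ d_s^p b_s = 0` in `k`), then the images of the `b_s` in `κ` are
`κ^p`-linearly independent (no non-trivial relation `Σ e_s^p b_s = 0` in `κ`).  [MacLane 1939, Thm. 11; Mathlib linear disjointness] -/
theorem pow_linearIndependent_of_isSeparable (p : ℕ) [Fact p.Prime] {k κ : Type} [Field k] [CharP k p] [Field κ] [Algebra k κ]
    [Algebra.IsSeparable k κ] {S : Type} (b : S → k)
    (hbli : ∀ (s₀ : Finset S) (d : S → k), ∑ i ∈ s₀, d i ^ p * b i = 0 → ∀ i ∈ s₀, d i = 0)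
    (s₀ : Finset S) (e : S → κ) (he : ∑ i ∈ s₀, e i ^ p * algebraMap k κ (b i) = 0) : ∀ i ∈ s₀, e i = 0 := by
  classical
  have hp : p.Prime := Fact.out
  haveI : ExpChar k p := ExpChar.prime hp
  haveI : CharP κ p := ((algebraMap k κ).charP_iff_charP p).mp inferInstance
  haveI : ExpChar κ p := ExpChar.prime hp
  -- ## the small field `F = k^p ⊆ k` and the tower `F → k → κ` (canonical `Subfield` instances)
  set F : Subfield k := (frobenius k p).fieldRange with hFdef
  haveI : CharP F p := ((algebraMap F k).charP_iff_charP p).mpr inferInstance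
  haveI : ExpChar F p := ExpChar.prime hp
  have halgF : ∀ x : F, algebraMap F κ x = algebraMap k κ (x : k) := fun _ => rfl
  -- ## `k/F` is purely inseparable (of height one)
  haveI : IsPurelyInseparable F k := by
    rw [isPurelyInseparable_iff_pow_mem F p]
    intro x
    refine ⟨1, ⟨⟨x ^ p, RingHom.mem_fieldRange.mpr ⟨x, frobenius_def _ _⟩⟩, ?_⟩⟩
    rw [pow_one]; rfl
  -- ## `κ^p` as an intermediate field of `κ/F`
  have hmemSp : ∀ x : F, algebraMap F κ x ∈ (frobenius κ p).fieldRange := fun x => by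
    obtain ⟨c, hc⟩ := RingHom.mem_fieldRange.mp x.2
    refine RingHom.mem_fieldRange.mpr ⟨algebraMap k κ c, ?_⟩
    rw [frobenius_def, ← map_pow, ← frobenius_def, hc, halgF]
  let Sp : IntermediateField F κ := ((frobenius κ p).fieldRange).toIntermediateField hmemSp
  have hmemSp_iff : ∀ y : κ, y ∈ Sp ↔ y ∈ (frobenius κ p).fieldRange := fun _ => Iff.rfl
  -- ## `Sp/F` is separable: transport `κ/k` along the two Frobenius isomorphisms `k ≃ F`, `κ ≃ Sp`
  haveI : Algebra.IsSeparable F Sp := by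
    let φ₁ : k →+* F := (frobenius k p).codRestrict F (fun x => RingHom.mem_fieldRange.mpr ⟨x, rfl⟩)
    have hφ₁ : Function.Bijective φ₁ := by
      refine ⟨φ₁.injective, fun y => ?_⟩
      obtain ⟨x, hx⟩ := RingHom.mem_fieldRange.mp y.2
      exact ⟨x, Subtype.ext hx⟩
    let e₁ : k ≃+* F := RingEquiv.ofBijective φ₁ hφ₁
    let φ₂ : κ →+* Sp := (frobenius κ p).codRestrict Sp (fun y => (hmemSp_iff _).mpr (RingHom.mem_fieldRange.mpr ⟨y, rfl⟩))
    have hφ₂ : Function.Bijective φ₂ := by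
      refine ⟨φ₂.injective, fun y => ?_⟩
      obtain ⟨x, hx⟩ := RingHom.mem_fieldRange.mp ((hmemSp_iff _).mp y.2)
      exact ⟨x, Subtype.ext hx⟩
    let e₂ : κ ≃+* Sp := RingEquiv.ofBijective φ₂ hφ₂
    have he : (algebraMap F Sp).comp (e₁ : k →+* F) = (e₂ : κ →+* Sp).comp (algebraMap k κ) := by
      ext c
      show algebraMap F κ (φ₁ c) = (φ₂ (algebraMap k κ c) : κ)
      rw [halgF]
      show algebraMap k κ (frobenius k p c) = frobenius κ p (algebraMap k κ c)
      rw [frobenius_def, frobenius_def, map_pow]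
    exact Algebra.IsSeparable.of_equiv_equiv e₁ e₂ he
  -- ## linear disjointness (Mathlib) and the transfer of linear independence from `F` to `Sp = κ^p`
  have H : Sp.LinearDisjoint k := IntermediateField.linearDisjoint_of_isPurelyInseparable_of_isSeparable (E := k) Sp
  have hbF : LinearIndependent F b := by
    rw [linearIndependent_iff']
    intro s g hg i hi
    have hroot : ∀ j, ∃ d : k, d ^ p = (g j : k) := fun j => by
      obtain ⟨d, hd⟩ := RingHom.mem_fieldRange.mp (g j).2
      exact ⟨d, by rw [← hd, frobenius_def]⟩
    choose d hd using hroot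
    have hrel : ∑ j ∈ s, d j ^ p * b j = 0 := by
      rw [← hg]
      exact Finset.sum_congr rfl fun j _ => by rw [hd, Subfield.smul_def, smul_eq_mul]
    have := hbli s d hrel i hi
    apply Subtype.ext
    rw [← hd i, this, zero_pow hp.ne_zero]; rfl
  have hbSp : LinearIndependent Sp (algebraMap k κ ∘ b) := H.linearIndependent_right' hbF
  -- ## read off the elementary statement
  intro i hi
  rw [linearIndependent_iff'] at hbSp
  let g : S → Sp := fun j => ⟨e j ^ p, (hmemSp_iff _).mpr (RingHom.mem_fieldRange.mpr ⟨e j, frobenius_def _ _⟩)⟩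
  have hg : ∑ j ∈ s₀, g j • (algebraMap k κ ∘ b) j = 0 := by
    rw [← he]
    exact Finset.sum_congr rfl fun j _ => by rw [IntermediateField.smul_def, smul_eq_mul]; rfl
  have h2 : e i ^ p = 0 := congrArg Subtype.val (hbSp s₀ g hg i hi)
  exact (pow_eq_zero_iff hp.ne_zero).mp h2

/-- **Bridge B1 (Mac Lane), separable direction, along a valuation.**  Let the constants be `v`-integral (`hk`) and let `κ_v = O/𝔪_v` carry
ANY `k`-algebra structure compatible with `k → O → κ_v` (`hcomp`).  If `κ_v/k` is SEPARABLE, then every `k^p`-linearly independent family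
`b` of constants is residually `p`-independent along `v` (§B″ (RPI∞)): a relation `Σ w_s^p b_s ∈ 𝔪_v` with some `w_s` a unit would reduce to a
non-trivial `κ_v^p`-relation among the `b̄_s`, excluded by `pow_linearIndependent_of_isSeparable`. [MacLane 1939; folklore] -/
theorem residuallyPIndependentFamilyInf_of_isSeparable (p : ℕ) [Fact p.Prime] {k K : Type} [Field k] [CharP k p]
    [Field K] [Algebra k K] (O : ValuationSubring K) (hk : ∀ c : k, algebraMap k K c ∈ O)
    [Algebra k (IsLocalRing.ResidueField O)]
    (hcomp : ∀ (c : k) (h : algebraMap k K c ∈ O),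
      algebraMap k (IsLocalRing.ResidueField O) c = IsLocalRing.residue O ⟨algebraMap k K c, h⟩)
    [Algebra.IsSeparable k (IsLocalRing.ResidueField O)]
    {S : Type} (b : S → k)
    (hbli : ∀ (s₀ : Finset S) (d : S → k), ∑ i ∈ s₀, d i ^ p * b i = 0 → ∀ i ∈ s₀, d i = 0) :
    ResiduallyPIndependentFamilyInf p O (fun s => algebraMap k K (b s)) := by
  classical
  intro s₀ w hw hw1
  let wO : S → O := fun j => ⟨w j, hw j⟩
  let BO : S → O := fun j => ⟨algebraMap k K (b j), hk (b j)⟩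
  set xO : O := ∑ j ∈ s₀, wO j ^ p * BO j with hxOdef
  have hx : (xO : K) = ∑ j ∈ s₀, w j ^ p * algebraMap k K (b j) := by
    rw [hxOdef]; push_cast; rfl
  have hle : O.valuation (∑ j ∈ s₀, w j ^ p * algebraMap k K (b j)) ≤ 1 := by
    rw [← hx]; exact (O.valuation_le_one_iff _).mpr xO.2
  by_contra hne
  have hlt : O.valuation (∑ j ∈ s₀, w j ^ p * algebraMap k K (b j)) < 1 := lt_of_le_of_ne hle hne
  rw [← hx, ← O.valuation_lt_one_iff] at hlt
  have hres : IsLocalRing.residue O xO = 0 := (IsLocalRing.residue_eq_zero_iff _).mpr hlt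
  have hsum : ∑ j ∈ s₀, IsLocalRing.residue O (wO j) ^ p * algebraMap k (IsLocalRing.ResidueField O) (b j) = 0 := by
    rw [← hres, hxOdef, map_sum]
    exact Finset.sum_congr rfl fun j _ => by rw [map_mul, map_pow, hcomp (b j) (hk (b j))]
  have hall := pow_linearIndependent_of_isSeparable p b hbli s₀ (fun j => IsLocalRing.residue O (wO j)) hsum
  obtain ⟨i, hi, hvi⟩ := hw1
  have hmax : wO i ∈ IsLocalRing.maximalIdeal O := (IsLocalRing.residue_eq_zero_iff _).mp (hall i hi)
  have hlt1 : O.valuation (w i) < 1 := (O.valuation_lt_one_iff _).mp hmax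
  exact absurd hvi hlt1.ne

/-- **Every field of characteristic `p` has a `k^p`-basis**, i.e. a family `b` which is `p`-spanning with finitely supported sums (§B″ (SPAN∞))
AND `k^p`-linearly independent (`Module.Free.chooseBasis` over the subfield `k^p`). [folklore] -/
theorem exists_pBasisFamilyInf (p : ℕ) [Fact p.Prime] (k : Type) [Field k] [CharP k p] :
    ∃ (S : Type) (b : S → k), IsPSpanningFamilyInf p b ∧
      ∀ (s₀ : Finset S) (d : S → k), ∑ i ∈ s₀, d i ^ p * b i = 0 → ∀ i ∈ s₀, d i = 0 := by
  classical
  have hp : p.Prime := Fact.out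
  let kp : Subfield k := (frobenius k p).fieldRange
  let B := Module.Free.chooseBasis kp k
  have hroot : ∀ x : kp, ∃ d : k, d ^ p = (x : k) := fun x => by
    obtain ⟨d, hd⟩ := RingHom.mem_fieldRange.mp x.2
    exact ⟨d, by rw [← hd, frobenius_def]⟩
  choose rt hrt using hroot
  refine ⟨Module.Free.ChooseBasisIndex kp k, fun i => B i,
    fun c => ⟨(B.repr c).support, fun i => rt (B.repr c i), ?_⟩, fun s₀ d hd i hi => ?_⟩
  · conv_lhs => rw [← B.linearCombination_repr c, Finsupp.linearCombination_apply, Finsupp.sum]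
    refine Finset.sum_congr rfl fun i _ => ?_
    rw [hrt, Subfield.smul_def, smul_eq_mul]
  · have hli := B.linearIndependent
    rw [linearIndependent_iff'] at hli
    let g : Module.Free.ChooseBasisIndex kp k → kp := fun j => ⟨d j ^ p, RingHom.mem_fieldRange.mpr ⟨d j, frobenius_def _ _⟩⟩
    have hg : ∑ j ∈ s₀, g j • B j = 0 := by
      rw [← hd]
      exact Finset.sum_congr rfl fun j _ => by rw [Subfield.smul_def, smul_eq_mul]
    have h2 : d i ^ p = 0 := congrArg Subtype.val (hli s₀ g hg i hi)
    exact (pow_eq_zero_iff hp.ne_zero).mp h2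

/-- **THEOREM T″'s slice**: `stub_cleanLU3DefectNonDiscrete` at `p` on {`[Γ : pΓ] = p²`, `K/k` separably generated, `κ_v/k` SEPARABLE} — the
last condition stated with Mathlib's `Algebra.IsSeparable` for any `k`-algebra structure on `κ_v = IsLocalRing.ResidueField O` compatible with
`k → O → κ_v`; NO `PerfectField k`, NO finiteness of `[k : k^p]`, NO auxiliary family. [folklore] -/
def CleanLU3DefectPRankTwoSepResAt (p : ℕ) : Prop :=
    ∀ (k : Type) [Field k] [CharP k p] (K : Type) [Field K] [Algebra k K]
    (O : ValuationSubring K) (A : Subalgebra k K), A.toSubring ≤ O.toSubring → A.FG → IsFractionRing A K →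
    ringKrullDim A ≤ 3 → IsRegularLocalRing (locAtCentre A.toSubring O) →
    ringKrullDim (locAtCentre A.toSubring O) = 3 →
    (∀ (T : Subring K) (hT : T ≤ O.toSubring), A.toSubring ≤ T → (subringCentre T O hT).IsMaximal) →
    ∀ g₀ : K, (∀ c : K, c ^ p ≠ g₀) →
    (∀ f₀ : K, ∃ f₁ : K, O.valuation (g₀ - f₁ ^ p) < O.valuation (g₀ - f₀ ^ p)) →
    (∀ hk : ∀ c : k, algebraMap k K c ∈ O, transcendenceDefect k O hk ≠ 0) →
    ¬ (∃ π : K, π ≠ 0 ∧ (∀ x : K, O.valuation x < 1 → O.valuation x ≤ O.valuation π) ∧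
      (∀ x : K, x ≠ 0 → ∃ n : ℕ, O.valuation π ^ n ≤ O.valuation x)) →
    PRankTwoAt p O → SepGenerated k K →
    ∀ [Algebra k (IsLocalRing.ResidueField O)],
      (∀ (c : k) (h : algebraMap k K c ∈ O),
        algebraMap k (IsLocalRing.ResidueField O) c = IsLocalRing.residue O ⟨algebraMap k K c, h⟩) →
      Algebra.IsSeparable k (IsLocalRing.ResidueField O) →
    CleanLUConcl p k K O A g₀

/-- **T″ ⊂ T′_∞**: over ANY ground field, «`κ_v/k` separable» supplies T′_∞'s family — a `k^p`-basis of `k` (`exists_pBasisFamilyInf`),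
residually `p`-independent by Bridge B1 (`residuallyPIndependentFamilyInf_of_isSeparable`). [folklore] -/
theorem cleanLU3DefectPRankTwoSepRes_of_sepInf (p : ℕ) [Fact p.Prime] (hInf : CleanLU3DefectPRankTwoSepInfAt p) :
    CleanLU3DefectPRankTwoSepResAt p := by
  intro k _ _ K _ _ O A hAO hAfg hFrac hdimA hreg hdim3 hzd g₀ hg₀ hdefect htd hnd hP2 hsep _ hcomp hks
  have hk : ∀ c : k, algebraMap k K c ∈ O := fun c => hAO (A.algebraMap_mem c)
  obtain ⟨S, b, hb, hbli⟩ := exists_pBasisFamilyInf p k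
  exact hInf k K O A hAO hAfg hFrac hdimA hreg hdim3 hzd g₀ hg₀ hdefect htd hnd hP2 hsep S b hb
    (residuallyPIndependentFamilyInf_of_isSeparable p O hk hcomp b hbli)

/-! ## §J (rev 3) UPTAKE: the ∃-form of T″ for the lead's `by_cases` in `cleanLU3DefectNonDiscrete_of_stubs`, and (SEP-K) automatic over a perfect
ground field (Mathlib `exists_isTranscendenceBasis_and_isSeparable_of_perfectField`), so that T″ ⊇ T EXACTLY whenever `κ_v/k` is separable algebraic -/

/-- **Uptake form of T″.**  The binders of `stub_cleanLU3DefectNonDiscrete` (Sketch rev 28 :279) up to `¬ (discrete of rank one)`, then the POSITIVE side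
condition «`[Γ:pΓ] = p²` ∧ `K/k` separably generated ∧ `κ_v/k` separable for SOME `k`-algebra structure on `κ_v` compatible with `k → O → κ_v`» (the
negation of the proposed fifth negated hypothesis of a rev-29 cut), give the conclusion.  Template for the lead's new `by_cases` branch:
`· haveI : Fact p.Prime := ⟨hp⟩; exact cleanLUConcl_of_sepRes p (cleanLU3DefectPRankTwoSepRes_of_cossartPiltant2019 p stub_cossartPiltant2019
stub_cjs2020Cor15) k K O A hAO hAfg hfrac hdimA hreg hdim3 hzd g₀ hg₀ hdefect htd hdisc h5`. [folklore] -/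
theorem cleanLUConcl_of_sepRes (p : ℕ) (hT : CleanLU3DefectPRankTwoSepResAt p)
    (k : Type) [Field k] [CharP k p] (K : Type) [Field K] [Algebra k K]
    (O : ValuationSubring K) (A : Subalgebra k K) (hAO : A.toSubring ≤ O.toSubring) (hAfg : A.FG) (hFrac : IsFractionRing A K)
    (hdimA : ringKrullDim A ≤ 3) (hreg : IsRegularLocalRing (locAtCentre A.toSubring O))
    (hdim3 : ringKrullDim (locAtCentre A.toSubring O) = 3)
    (hzd : ∀ (T : Subring K) (hT : T ≤ O.toSubring), A.toSubring ≤ T → (subringCentre T O hT).IsMaximal)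
    (g₀ : K) (hg₀ : ∀ c : K, c ^ p ≠ g₀)
    (hdefect : ∀ f₀ : K, ∃ f₁ : K, O.valuation (g₀ - f₁ ^ p) < O.valuation (g₀ - f₀ ^ p))
    (htd : ∀ hk : ∀ c : k, algebraMap k K c ∈ O, transcendenceDefect k O hk ≠ 0)
    (hnd : ¬ (∃ π : K, π ≠ 0 ∧ (∀ x : K, O.valuation x < 1 → O.valuation x ≤ O.valuation π) ∧
      (∀ x : K, x ≠ 0 → ∃ n : ℕ, O.valuation π ^ n ≤ O.valuation x)))
    (h5 : PRankTwoAt p O ∧ SepGenerated k K ∧ ∃ _ : Algebra k (IsLocalRing.ResidueField O),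
      (∀ (c : k) (h : algebraMap k K c ∈ O),
        algebraMap k (IsLocalRing.ResidueField O) c = IsLocalRing.residue O ⟨algebraMap k K c, h⟩) ∧
      Algebra.IsSeparable k (IsLocalRing.ResidueField O)) :
    CleanLUConcl p k K O A g₀ := by
  obtain ⟨hP2, hsep, inst, hcomp, hks⟩ := h5
  exact hT k K O A hAO hAfg hFrac hdimA hreg hdim3 hzd g₀ hg₀ hdefect htd hnd hP2 hsep hcomp hks

/-- **(SEP-K) is automatic over a PERFECT ground field** for `K = Frac A`, `A` of finite type over `k` (Mathlib: a finitely generated extension of a perfect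
field is separably generated, `exists_isTranscendenceBasis_and_isSeparable_of_perfectField`; re-indexed to the census def `SepGenerated`). [folklore] -/
theorem sepGenerated_of_perfectField {k K : Type} [Field k] [PerfectField k] [Field K] [Algebra k K]
    (A : Subalgebra k K) (hAfg : A.FG) (hFrac : IsFractionRing A K) : SepGenerated k K := by
  classical
  haveI : Algebra.FiniteType k A := (Subalgebra.fg_iff_finiteType A).mp hAfg
  haveI : Algebra.EssFiniteType A K := Algebra.EssFiniteType.of_isLocalization (R := A) (S := K) (nonZeroDivisors A)
  haveI : Algebra.EssFiniteType k K := Algebra.EssFiniteType.comp k A K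
  obtain ⟨s, hs, hsepK⟩ := exists_isTranscendenceBasis_and_isSeparable_of_perfectField k K
  have hrange : Set.range (fun i : Fin s.card => ((s.equivFin.symm i : s) : K)) = (s : Set K) := by
    ext x
    constructor
    · rintro ⟨i, rfl⟩
      exact (s.equivFin.symm i).2
    · intro hx
      exact ⟨s.equivFin ⟨x, hx⟩, by simp only [Equiv.symm_apply_apply]⟩
  refine ⟨s.card, fun i => ((s.equivFin.symm i : s) : K), hs.1.comp _ s.equivFin.symm.injective, ?_⟩
  rw [hrange]
  exact hsepK

/-! ## §K (rev 4) THE RESIDUE FIELD IS ALGEBRAIC IN THE :279 REGIME (Zariski's lemma on every model), HENCE T″ ⊇ T IN KERNEL -/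

/-- **Zero-dimensional valuations have algebraic residue field.**  If the centre of `v` on EVERY finite-type model `T ⊇ A` of `K/k` inside `O_v` is a
maximal ideal (the :279 hypothesis `hzd`), then every residue class `ō ∈ κ_v` of an `o ∈ O_v` is integral over `k` (apply `hzd` to `T := A[o]`; `T/𝔠`
is a field of finite type over `k`, hence algebraic by Zariski's lemma — Mathlib `MvPolynomial.comp_C_integral_of_surjective_of_isJacobsonRing`; and
`T/𝔠 ↪ κ_v`).  The `k`-algebra structure on `κ_v` is any one compatible with `k → O_v → κ_v`. [folklore] -/
theorem residue_isIntegral_of_centres_maximal {k K : Type} [Field k] [Field K] [Algebra k K]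
    (O : ValuationSubring K) (A : Subalgebra k K) (hAO : A.toSubring ≤ O.toSubring) (hAfg : A.FG)
    (hzd : ∀ (T : Subring K) (hT : T ≤ O.toSubring), A.toSubring ≤ T → (subringCentre T O hT).IsMaximal)
    [Algebra k (IsLocalRing.ResidueField O)]
    (hcomp : ∀ (c : k) (h : algebraMap k K c ∈ O),
      algebraMap k (IsLocalRing.ResidueField O) c = IsLocalRing.residue O ⟨algebraMap k K c, h⟩)
    (o : K) (ho : o ∈ O) : IsIntegral k (IsLocalRing.residue O ⟨o, ho⟩) := by
  classical
  have hk : ∀ c : k, algebraMap k K c ∈ O := fun c => hAO (A.algebraMap_mem c)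
  obtain ⟨s, hs⟩ := hAfg
  -- the model `T := k[s, o] = A[o]`
  let σ : Finset K := insert o s
  let v : ↥σ → K := fun x => (x : K)
  let T' : Subalgebra k K := Algebra.adjoin k (σ : Set K)
  have hrange : Set.range v = (σ : Set K) := by
    ext x
    constructor
    · rintro ⟨i, rfl⟩
      exact i.2
    · intro hx
      exact ⟨⟨x, hx⟩, rfl⟩
  have hT'eq : T' = (MvPolynomial.aeval (R := k) v).range := by
    show Algebra.adjoin k (σ : Set K) = _
    rw [← hrange]
    exact Algebra.adjoin_range_eq_range_aeval k v
  -- `T' ⊆ O`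
  let OA : Subalgebra k K :=
    { O.toSubring with
      algebraMap_mem' := fun c => hk c }
  have hσO : (σ : Set K) ⊆ (OA : Set K) := by
    intro x hx
    rcases Finset.mem_insert.mp (Finset.mem_coe.mp hx) with rfl | hx'
    · exact ho
    · exact hAO (show x ∈ A from hs ▸ Algebra.subset_adjoin hx')
  have hT'O : T' ≤ OA := Algebra.adjoin_le hσO
  have hT : T'.toSubring ≤ O.toSubring := fun x hx => hT'O hx
  have hAT : A.toSubring ≤ T'.toSubring := by
    intro x hx
    have hx' : x ∈ Algebra.adjoin k (s : Set K) := hs.symm ▸ hx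
    exact Algebra.adjoin_mono (by intro y hy; exact Finset.mem_coe.mpr (Finset.mem_insert_of_mem (Finset.mem_coe.mp hy))) hx'
  have hmax : (subringCentre T'.toSubring O hT).IsMaximal := hzd T'.toSubring hT hAT
  -- the field `T/𝔠` and the surjection from the polynomial ring
  set 𝔠 : Ideal ↥T'.toSubring := subringCentre T'.toSubring O hT with h𝔠
  letI : Field (↥T'.toSubring ⧸ 𝔠) := @Ideal.Quotient.field _ _ 𝔠 hmax
  have hmemT : ∀ P : MvPolynomial ↥σ k, MvPolynomial.aeval v P ∈ T'.toSubring := fun P => by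
    rw [Subalgebra.mem_toSubring, hT'eq]
    exact ⟨P, rfl⟩
  let ψ : MvPolynomial ↥σ k →+* ↥T'.toSubring := (MvPolynomial.aeval v).toRingHom.codRestrict T'.toSubring hmemT
  have hψ : Function.Surjective ψ := by
    intro t
    have ht : (t : K) ∈ (MvPolynomial.aeval (R := k) v).range := by
      rw [← hT'eq]
      exact (Subalgebra.mem_toSubring).mp t.2
    obtain ⟨P, hP⟩ := ht
    exact ⟨P, Subtype.ext hP⟩
  let g : MvPolynomial ↥σ k →+* (↥T'.toSubring ⧸ 𝔠) := (Ideal.Quotient.mk 𝔠).comp ψ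
  have hg : Function.Surjective g := (Ideal.Quotient.mk_surjective).comp hψ
  have hint : (g.comp MvPolynomial.C).IsIntegral := MvPolynomial.comp_C_integral_of_surjective_of_isJacobsonRing g hg
  -- the embedding `T/𝔠 → κ_v`
  let ι₀ : ↥T'.toSubring →+* IsLocalRing.ResidueField O := (IsLocalRing.residue O).comp (Subring.inclusion hT)
  have hι₀ : ∀ a : ↥T'.toSubring, a ∈ 𝔠 → ι₀ a = 0 := by
    intro a ha
    show IsLocalRing.residue O (Subring.inclusion hT a) = 0
    rw [IsLocalRing.residue_eq_zero_iff]
    rw [h𝔠, subringCentre_eq] at ha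
    exact ha
  let ι : (↥T'.toSubring ⧸ 𝔠) →+* IsLocalRing.ResidueField O := Ideal.Quotient.lift 𝔠 ι₀ hι₀
  -- the generator `o` as an element of `T`
  have hoT : o ∈ T'.toSubring := by
    rw [Subalgebra.mem_toSubring]
    exact Algebra.subset_adjoin (Finset.mem_coe.mpr (Finset.mem_insert_self o s))
  have hιo : ι (Ideal.Quotient.mk 𝔠 ⟨o, hoT⟩) = IsLocalRing.residue O ⟨o, ho⟩ := by
    show ι₀ ⟨o, hoT⟩ = _
    rfl
  have hιgC : (ι.comp (g.comp MvPolynomial.C)) = algebraMap k (IsLocalRing.ResidueField O) := by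
    ext c
    show ι (Ideal.Quotient.mk 𝔠 (ψ (MvPolynomial.C c))) = _
    rw [Ideal.Quotient.lift_mk]
    have hψC : ψ (MvPolynomial.C c) = ⟨algebraMap k K c, hAT (A.algebraMap_mem c)⟩ := by
      apply Subtype.ext
      show MvPolynomial.aeval v (MvPolynomial.C c) = algebraMap k K c
      exact MvPolynomial.algHom_C _ c
    rw [hψC, hcomp c (hk c)]
    rfl
  obtain ⟨P, hPmonic, hP⟩ := hint (Ideal.Quotient.mk 𝔠 ⟨o, hoT⟩)
  refine ⟨P, hPmonic, ?_⟩
  have h1 := congrArg ι hP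
  rw [Polynomial.hom_eval₂, map_zero, hιgC, hιo] at h1
  exact h1

/-- **In the :279 regime `κ_v/k` is algebraic** (corollary; `Algebra.IsAlgebraic` for any compatible `k`-algebra structure on `κ_v`). [folklore] -/
theorem isAlgebraic_residueField_of_centres_maximal {k K : Type} [Field k] [Field K] [Algebra k K]
    (O : ValuationSubring K) (A : Subalgebra k K) (hAO : A.toSubring ≤ O.toSubring) (hAfg : A.FG)
    (hzd : ∀ (T : Subring K) (hT : T ≤ O.toSubring), A.toSubring ≤ T → (subringCentre T O hT).IsMaximal)
    [Algebra k (IsLocalRing.ResidueField O)]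
    (hcomp : ∀ (c : k) (h : algebraMap k K c ∈ O),
      algebraMap k (IsLocalRing.ResidueField O) c = IsLocalRing.residue O ⟨algebraMap k K c, h⟩) :
    Algebra.IsAlgebraic k (IsLocalRing.ResidueField O) := by
  have hintegral : Algebra.IsIntegral k (IsLocalRing.ResidueField O) := by
    refine ⟨fun y => ?_⟩
    obtain ⟨x, rfl⟩ := IsLocalRing.residue_surjective y
    exact residue_isIntegral_of_centres_maximal O A hAO hAfg hzd hcomp x.1 x.2
  exact Algebra.IsIntegral.isAlgebraic

/-- **T″ ⊇ T IN KERNEL.**  Over a PERFECT ground field both extra binders of T″ are free: (SEP-K) by `sepGenerated_of_perfectField`, and `κ_v/k` separable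
because it is algebraic (`isAlgebraic_residueField_of_centres_maximal`) over a perfect field (Mathlib `Algebra.IsAlgebraic.isSeparable_of_perfectField`), for
the `k`-algebra structure `k → O_v → κ_v`.  Hence THEOREM T's slice `CleanLU3DefectPRankTwoAt p` (✓ `PRankTwoCurrency`) follows from T″'s. [folklore] -/
theorem cleanLU3DefectPRankTwo_of_sepRes (p : ℕ) (hT : CleanLU3DefectPRankTwoSepResAt p) : CleanLU3DefectPRankTwoAt p := by
  intro k _ _ _ K _ _ O A hAO hAfg hFrac hdimA hreg hdim3 hzd g₀ hg₀ hdefect htd hnd hP2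
  have hk : ∀ c : k, algebraMap k K c ∈ O := fun c => hAO (A.algebraMap_mem c)
  letI alg : Algebra k (IsLocalRing.ResidueField O) := ((IsLocalRing.residue O).comp ((algebraMap k K).codRestrict O hk)).toAlgebra
  have hcomp : ∀ (c : k) (h : algebraMap k K c ∈ O),
      algebraMap k (IsLocalRing.ResidueField O) c = IsLocalRing.residue O ⟨algebraMap k K c, h⟩ := fun c h => rfl
  haveI : Algebra.IsAlgebraic k (IsLocalRing.ResidueField O) := isAlgebraic_residueField_of_centres_maximal O A hAO hAfg hzd hcomp
  haveI : Algebra.IsSeparable k (IsLocalRing.ResidueField O) := Algebra.IsAlgebraic.isSeparable_of_perfectField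
  exact hT k K O A hAO hAfg hFrac hdimA hreg hdim3 hzd g₀ hg₀ hdefect htd hnd hP2 (sepGenerated_of_perfectField A hAfg hFrac) hcomp inferInstance

end Summit.ResolutionOfSingularities.ResolutionOfSingularities.Theorems.RadicialJung.CleanModels.Lens5.PRankTwoSepFinCurrency
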